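import Literature.IUT.HodgeTheaters.InitialThetaDataSplitProofs
import Literature.IUT.HodgeTheaters.GaloisValDatumOfComplete
import Literature.IUT.HodgeTheaters.BadLocalFrobenioidOfKits
import HarnessLib

/-!
# [IUTchI] Example 3.2 (iv) AT THE GENUINE DATUM: `q_v̲`, `q̲_v̲ = q_v̲^{1/2l} ∈ 𝒪^▷_{K_v̲}` and the `p_v`-adic
# Frobenioid `C⊢_v̲` over `𝓑(K_v̲)⁰`, for initial Θ-data `D` and a place `v̲` of `K` over `V(F)^bad`

Mochizuki, *Inter-universal Teichmüller Theory I*, kurims manuscript (May 2020), Example 3.2 (iv) p. 71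
[cite: Mochizuki2012, I Ex 3.2 (iv) p.71] (D-0012 claim key, status disputed; nothing of the series is asserted).
Print: "Write `q_v` for the `q`-parameter of the elliptic curve `E_v` over `K_v`. Thus, we may think of `q_v` as an
element `q_v ∈ 𝒪^▷(T_{X̲̲_v}) (≅ 𝒪^▷_{K_v})`. Note that it follows from our assumption concerning `2`-torsion [cf.
Definition 3.1, (b)], together with the definition of `K` [cf. Definition 3.1, (c)], that `q_v` admits a `2l`-th root
in `𝒪^▷(T_{X̲̲_v}) (≅ 𝒪^▷_{K_v})` … `q̲_v := q_v^{1/2l}` … the resulting submonoid `Φ_{C⊢_v} := ℕ·log_Φ(q̲_v)|_{D⊢_v}`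
… determines a `p_v`-adic Frobenioid with base category given by `D⊢_v` … `C⊢_v`".

THIS FILE instantiates the (C) assembly of `BadLocalFrobenioidOfKits.lean` at the REAL number-theoretic side of
abc-iut-L5-t2's `InitialThetaData D` (`InitialThetaData.lean`): for `v ∈ V(F)^bad` (`D.VFbad`), a place `w` of `K`
over `v` and the prime `p` under `w`, with `K_v̲ := K_w` the completion (abc-iut-S7's `RescaledCompletion K p w` = Mathlib's
`w.adicCompletion K` with the rescaled norm) and `G_v̲ := Gal(K̄_w/K_w)` (`GaloisValDatum.ofPlace K p w`, every
valuation-theoretic input DISCHARGED):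
* `tateParamAt`, `tateRootAt` — the Tate parameter `q_w ∈ K_w` of `E_K` (`tateJ q_w = j(E_F)`, `q_w ≠ 0`, `|q_w| < 1`,
  UNCONDITIONAL in the tree: Silverman ATAEC V.5.3) and its `2l`-th root `r`, `r^{2l} = q_w`, from abc-iut-L5-d209 /
  abc-iut-L5-t12's `exists_pow_two_mul_l_eq_tateParameter_of_mem_VFbad` (Def. 3.1 (b)(c) ⇒ split multiplicative
  reduction and full `2l`-torsion);
* `qParamAt`, `qRootAt : intNonzero K_w` — the same as elements of `𝒪^▷_{K_w}` for the norm relation, with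
  `qRootAt_pow : q̲^{2l} = q`, `qRootAt_not_isUnit` (`|q̲| < 1`);
* **`badCdashAt`** — the GENUINE `C⊢_v̲`: abc-iut-L1-t4's monogenic [FrdII] Ex. 1.1 (ii) Frobenioid of
  `ℕ·log_Φ(q̲_v̲)` over the REAL coset base `𝓑(K_v̲)⁰ = CosetCat Gal(K̄_w/K_w)` (`GaloisValDatum.Cdash`) — NO input left
  [cite: MochizukiFrdII2008, Ex 1.1 (ii) p.8]; `badTauDashAt` its splittings `τ(q″)`;
* `badLocalFrobenioidAt T Kt` — [IUTchI] Ex. 3.2 at the datum: `BadLocalFrobenioid.ofKits` with these `q_v̲`, `q̲_v̲`,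
  over an INPUT bad-place group datum `Π_v̲ → G_v̲ ⊇ Π_Ÿ` and an INPUT tempered side (the [EtTh] objects); its `q`,
  `C⊢_v̲` read back as the genuine ones (`badLocalFrobenioidAt_q`, `badLocalFrobenioidAt_Cdash`).
-/

noncomputable section

open scoped Classical
open WeierstrassCurve

namespace Literature.IUT.HodgeTheaters

open CategoryTheory Literature.NumberTheory.EllipticCurves Literature.NumberTheory.EllipticCurves.TateCurve
  NumberField IsDedekindDomain Literature.NumberTheory.NumberFields Literature.AlgebraicGeometry.Frobenioids
  Literature.AlgebraicGeometry.Frobenioids.PadicFrd Literature.AnabelianGeometry.SemiGraphs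

variable {F K Fbar : Type} [Field F] [NumberField F] [Field K] [NumberField K] [Algebra F K]
  [Field Fbar] [Algebra F Fbar] [Algebra K Fbar] [IsScalarTower F K Fbar] {E : WeierstrassCurve F}
  [E.IsElliptic] {l : ℕ} {Pb : BadPlacePredicates K} (D : InitialThetaData F K Fbar E l Pb)
  {v : FinitePlace F} (hv : v ∈ D.VFbad) (w : HeightOneSpectrum (𝓞 K)) [w.asIdeal.LiesOver v.maximalIdeal.asIdeal]

namespace InitialThetaData

/-! ### The Tate parameter of `E_K` at `w` and its `2l`-th root -/

include D hv in
/-- Existence (abc-iut-L5-d209 / L5-t12, unconditional over Def. 3.1): `q_w ≠ 0`, `‖q_w‖ < 1`, `tateJ q_w = j(E_F)`,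
`r^{2l} = q_w` in `K_w`. [cite: Mochizuki2012, I Ex 3.2 (iv) p.71] -/
theorem exists_tateParam_root :
    ∃ q r : w.adicCompletion K, q ≠ 0 ∧ ‖q‖ < 1 ∧
      tateJ q = algebraMap K (w.adicCompletion K) (E.baseChange K).j ∧ r ^ (2 * l) = q := by
  obtain ⟨q, r, h0, h1, hj, hr, -⟩ := D.exists_pow_two_mul_l_eq_tateParameter_of_mem_VFbad hv w
  exact ⟨q, r, h0, h1, hj, hr⟩

/-- **`q_v̲`**, "the `q`-parameter of the elliptic curve `E_v` over `K_v`" (a chosen Tate parameter of `E_K` at `w`).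
[cite: Mochizuki2012, I Ex 3.2 (iv) p.71] -/
def tateParamAt : w.adicCompletion K := Classical.choose (D.exists_tateParam_root hv w)

/-- **`q̲_v̲ := q_v̲^{1/2l}`**, a chosen `2l`-th root of `q_v̲` in `K_v̲`. [cite: Mochizuki2012, I Ex 3.2 (iv) p.71] -/
def tateRootAt : w.adicCompletion K := Classical.choose (Classical.choose_spec (D.exists_tateParam_root hv w))

/-- The defining properties of `q_v̲`, `q̲_v̲`. [cite: Mochizuki2012, I Ex 3.2 (iv) p.71] -/
theorem tateRootAt_spec :
    D.tateParamAt hv w ≠ 0 ∧ ‖D.tateParamAt hv w‖ < 1 ∧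
      tateJ (D.tateParamAt hv w) = algebraMap K (w.adicCompletion K) (E.baseChange K).j ∧
      D.tateRootAt hv w ^ (2 * l) = D.tateParamAt hv w :=
  Classical.choose_spec (Classical.choose_spec (D.exists_tateParam_root hv w))

/-- `q̲_v̲^{2l} = q_v̲`. [cite: Mochizuki2012, I Ex 3.2 (iv) p.71] -/
theorem tateRootAt_pow : D.tateRootAt hv w ^ (2 * l) = D.tateParamAt hv w := (D.tateRootAt_spec hv w).2.2.2

/-- `q_v̲` IS the Tate parameter: `j(q_v̲) = j(E_F)`. [cite: Mochizuki2012, I Ex 3.2 (iv) p.71] -/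
theorem tateJ_tateParamAt :
    tateJ (D.tateParamAt hv w) = algebraMap K (w.adicCompletion K) (E.baseChange K).j :=
  (D.tateRootAt_spec hv w).2.2.1

/-- `v(q_v̲) < 1`. [cite: Mochizuki2012, I Ex 3.2 (iv) p.71] -/
theorem valued_tateParamAt_lt_one : Valued.v (D.tateParamAt hv w) < 1 :=
  Valued.toNormedField.norm_lt_one_iff.mp (D.tateRootAt_spec hv w).2.1

/-- `2l ≠ 0` for a prime `l`. [cite: Mochizuki2012, I Def 3.1 (c) p.62] -/
theorem two_mul_l_ne_zero (hl : l.Prime) : 2 * l ≠ 0 := Nat.mul_ne_zero two_ne_zero hl.pos.ne'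

/-- `v(q̲_v̲) < 1`. [cite: Mochizuki2012, I Ex 3.2 (iv) p.71] -/
theorem valued_tateRootAt_lt_one : Valued.v (D.tateRootAt hv w) < 1 := by
  by_contra h
  rw [not_lt] at h
  have h2 : (1 : WithZero (Multiplicative ℤ)) ≤ Valued.v (D.tateParamAt hv w) := by
    rw [← D.tateRootAt_pow hv w, map_pow]
    exact one_le_pow₀ h
  exact absurd (D.valued_tateParamAt_lt_one hv w) (not_lt.mpr h2)

/-- `q̲_v̲ ≠ 0`. [cite: Mochizuki2012, I Ex 3.2 (iv) p.71] -/
theorem tateRootAt_ne_zero : D.tateRootAt hv w ≠ 0 := fun h => by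
  have h2 := D.tateRootAt_pow hv w
  rw [h, zero_pow (two_mul_l_ne_zero D.l_prime)] at h2
  exact (D.tateRootAt_spec hv w).1 h2.symm

/-! ### As elements of `𝒪^▷_{K_v̲}` (the completion with its norm relation) -/

variable (p : ℕ) [Fact p.Prime] (hw : ((p : ℕ) : 𝓞 K) ∈ w.asIdeal)

omit [w.asIdeal.LiesOver v.maximalIdeal.asIdeal] in
/-- An element of `K_w` of valuation `≤ 1` and `≠ 0` is in `𝒪^▷_{K_v̲}` (norm relation of the rescaled completion).
[cite: MochizukiFrdII2008, Ex 1.1 (i) p.7] -/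
theorem of_mem_intNonzero {y : w.adicCompletion K} (hy : Valued.v y ≤ 1) (hy0 : y ≠ 0) :
    RescaledCompletion.of K p w hw y ∈ intNonzero (GaloisValDatum.ofPlace K p w hw).k := by
  refine ⟨?_, (map_ne_zero _).mpr hy0⟩
  rw [← (ValuativeRel.valuation _).map_one, ← Valuation.Compatible.vle_iff_le]
  change ‖RescaledCompletion.of K p w hw y‖ ≤ ‖(1 : RescaledCompletion K p w hw)‖
  rw [norm_one]
  exact (Valued.toNormedField.norm_le_one_iff (L := RescaledCompletion K p w hw)
    (x := RescaledCompletion.of K p w hw y)).mpr hy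

/-- **`q_v̲ ∈ 𝒪^▷_{K_v̲}`**. [cite: Mochizuki2012, I Ex 3.2 (iv) p.71] -/
def qParamAt : intNonzero (GaloisValDatum.ofPlace K p w hw).k :=
  ⟨RescaledCompletion.of K p w hw (D.tateParamAt hv w),
    of_mem_intNonzero w p hw (D.valued_tateParamAt_lt_one hv w).le (D.tateRootAt_spec hv w).1⟩

/-- **`q̲_v̲ ∈ 𝒪^▷_{K_v̲}`**. [cite: Mochizuki2012, I Ex 3.2 (iv) p.71] -/
def qRootAt : intNonzero (GaloisValDatum.ofPlace K p w hw).k :=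
  ⟨RescaledCompletion.of K p w hw (D.tateRootAt hv w),
    of_mem_intNonzero w p hw (D.valued_tateRootAt_lt_one hv w).le (D.tateRootAt_ne_zero hv w)⟩

/-- `q̲_v̲^{2l} = q_v̲` in `𝒪^▷_{K_v̲}`. [cite: Mochizuki2012, I Ex 3.2 (iv) p.71] -/
theorem qRootAt_pow : D.qRootAt hv w p hw ^ (2 * l) = D.qParamAt hv w p hw :=
  Subtype.ext (by
    change RescaledCompletion.of K p w hw (D.tateRootAt hv w) ^ (2 * l) = RescaledCompletion.of K p w hw (D.tateParamAt hv w)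
    rw [← map_pow, D.tateRootAt_pow hv w])

/-- `q_v̲` read back in `K_w` is the Tate parameter. [cite: Mochizuki2012, I Ex 3.2 (iv) p.71] -/
theorem qParamAt_coe :
    ((D.qParamAt hv w p hw : (GaloisValDatum.ofPlace K p w hw).k) : RescaledCompletion K p w hw) =
      RescaledCompletion.of K p w hw (D.tateParamAt hv w) :=
  rfl

/-- **`q̲_v̲` is NOT a unit of `𝒪^▷_{K_v̲}`** (`v(q̲_v̲) < 1`): the monogenic [FrdII] datum of `C⊢_v̲` is defined.
[cite: Mochizuki2012, I Ex 3.2 (iv) p.71] -/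
theorem qRootAt_not_isUnit : ¬ IsUnit (D.qRootAt hv w p hw) := by
  rw [isUnit_intNonzero_iff]
  intro h
  have h1 : @ValuativeRel.vle _ _ (GaloisValDatum.ofPlace K p w hw).valk (1 : (GaloisValDatum.ofPlace K p w hw).k)
      (D.qRootAt hv w p hw : (GaloisValDatum.ofPlace K p w hw).k) := by
    rw [Valuation.Compatible.vle_iff_le (v := ValuativeRel.valuation (GaloisValDatum.ofPlace K p w hw).k), map_one, h]
  change ‖(1 : RescaledCompletion K p w hw)‖ ≤ ‖RescaledCompletion.of K p w hw (D.tateRootAt hv w)‖ at h1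
  rw [norm_one] at h1
  exact absurd ((Valued.toNormedField.norm_lt_one_iff (L := RescaledCompletion K p w hw)
    (x := RescaledCompletion.of K p w hw (D.tateRootAt hv w))).mpr (D.valued_tateRootAt_lt_one hv w)) (not_lt.mpr h1)

/-! ### The GENUINE `C⊢_v̲` and Example 3.2 at the datum -/

/-- **The GENUINE `C⊢_v̲`** of [IUTchI] Ex. 3.2 (iv) for initial Θ-data `D` at `v̲ = w ∣ v ∈ V(F)^bad`: the monogenic
`p_v`-adic Frobenioid of `Φ_{C⊢_v} := ℕ·log_Φ(q̲_v̲)` over the REAL base `𝓑(K_v̲)⁰ = CosetCat Gal(K̄_w/K_w)` — every input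
discharged. [cite: Mochizuki2012, I Ex 3.2 (iv) p.71] -/
abbrev badCdashAt : Type := (GaloisValDatum.ofPlace K p w hw).Cdash (D.qRootAt_not_isUnit hv w p hw)

/-- `C⊢_v̲ → D⊢_v̲ = 𝓑(K_v̲)⁰`. [cite: Mochizuki2012, I Ex 3.2 (iv) p.71] -/
abbrev badCdashBaseAt : D.badCdashAt hv w p hw ⥤ CosetCat (GaloisValDatum.ofPlace K p w hw).Gal :=
  (GaloisValDatum.ofPlace K p w hw).CdashBase (D.qRootAt_not_isUnit hv w p hw)

/-- `τ⊢_v̲` member by member (the splittings of the associates `q″` of `q̲_v̲`; `τ(q̲_v̲)` the recorded one).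
[cite: Mochizuki2012, I Ex 3.2 (iv) p.71] -/
abbrev badTauDashAt (q'' : intNonzero (GaloisValDatum.ofPlace K p w hw).k) :
    S3Local.CharSplitting (D.badCdashAt hv w p hw) :=
  (GaloisValDatum.ofPlace K p w hw).tauDashOf (D.qRootAt_not_isUnit hv w p hw) q''

/-- **[IUTchI] Example 3.2 AT THE DATUM**: the interface `BadLocalFrobenioid l K_v̲` for initial Θ-data `D` at
`v̲ = w ∣ v ∈ V(F)^bad`, with the GENUINE `q_v̲`, `q̲_v̲`, `D⊢_v̲ = 𝓑(K_v̲)⁰`, `C⊢_v̲`, over an INPUT group datum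
`Π_v̲ → G_v̲ ⊇ Π_Ÿ` (print: the tempered fundamental groups of `X̲̲_v̲`, `Ÿ_v̲`) and an INPUT tempered side (the [EtTh]
objects). [cite: Mochizuki2012, I Ex 3.2 pp.69-73] -/
def badLocalFrobenioidAt {P : Type} [Group P] [TopologicalSpace P]
    (T : BadLocalGroupDatum (GaloisValDatum.ofPlace K p w hw).Gal P) {Fv : Type} [Category.{0} Fv] {Fbirat : Type}
    [Category.{0} Fbirat] {Cv : Type} [Category.{0} Cv]
    (Kt : TemperedThetaInput (GaloisValDatum.ofPlace K p w hw) T (D.qRootAt_not_isUnit hv w p hw) Fv Fbirat Cv) :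
    BadLocalFrobenioid.{0} l (GaloisValDatum.ofPlace K p w hw).k :=
  BadLocalFrobenioid.ofKits l (GaloisValDatum.ofPlace K p w hw) T (D.qParamAt hv w p hw) (D.qRootAt hv w p hw)
    (D.qRootAt_pow hv w p hw) (D.qRootAt_not_isUnit hv w p hw) Kt

/-- Its `q_v`, `q̲_v` ARE the genuine `q_v̲`, `q̲_v̲`. [cite: Mochizuki2012, I Ex 3.2 (iv) p.71] -/
theorem badLocalFrobenioidAt_q {P : Type} [Group P] [TopologicalSpace P]
    (T : BadLocalGroupDatum (GaloisValDatum.ofPlace K p w hw).Gal P) {Fv : Type} [Category.{0} Fv] {Fbirat : Type}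
    [Category.{0} Fbirat] {Cv : Type} [Category.{0} Cv]
    (Kt : TemperedThetaInput (GaloisValDatum.ofPlace K p w hw) T (D.qRootAt_not_isUnit hv w p hw) Fv Fbirat Cv) :
    (D.badLocalFrobenioidAt hv w p hw T Kt).q = D.qParamAt hv w p hw ∧
      (D.badLocalFrobenioidAt hv w p hw T Kt).qroot = D.qRootAt hv w p hw :=
  ⟨rfl, rfl⟩

/-- Its `C⊢_v`, `τ⊢_v` ARE the genuine `C⊢_v̲`, `τ⊢_v̲`, and its `D⊢_v` IS `𝓑(K_v̲)⁰`. [cite: Mochizuki2012, I Ex 3.2 (iv) p.71] -/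
theorem badLocalFrobenioidAt_Cdash {P : Type} [Group P] [TopologicalSpace P]
    (T : BadLocalGroupDatum (GaloisValDatum.ofPlace K p w hw).Gal P) {Fv : Type} [Category.{0} Fv] {Fbirat : Type}
    [Category.{0} Fbirat] {Cv : Type} [Category.{0} Cv]
    (Kt : TemperedThetaInput (GaloisValDatum.ofPlace K p w hw) T (D.qRootAt_not_isUnit hv w p hw) Fv Fbirat Cv) :
    (D.badLocalFrobenioidAt hv w p hw T Kt).Cdash = D.badCdashAt hv w p hw ∧
      (D.badLocalFrobenioidAt hv w p hw T Kt).tauDashOf = D.badTauDashAt hv w p hw ∧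
      (D.badLocalFrobenioidAt hv w p hw T Kt).Ddash = CosetCat (GaloisValDatum.ofPlace K p w hw).Gal :=
  ⟨rfl, rfl, rfl⟩

end InitialThetaData

end Literature.IUT.HodgeTheaters

end
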